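import Summits.AtomisticToContinuum.Crystallization.Theorems.OverbindingBudgetAffineRunCutSheetAccess

/-!
# `OverbindingBudget` / crux `RobustDefectLimitWindows` (stmt-AtomisticToContinuum-31280) — «RunCut» part 22C «SHEETSTRADDLE»:
# THE STEEPEST STRADDLE OF A FOREIGN PLANE (local endgame of the pointwise crossing-exclusion engine, b-side)

Support file (lens-4 g89; order of record (2c), `ρ₁ = 30`; memo `g89/memo/TWOSHEET-g89.md` §4, §7).  The endgame `…RunCutCrossCore.crossing_pair_absurd`
consumes two CONSECUTIVE sites `b, b′` of one h-sheet on opposite sides of a plane `Π = (q₀, n)` (heights `≤ 0` and `≥ 0`).  This file produces them: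
from an h-site `b₀` of the ball whose chart axis is tilted against the unit vector `n` (`|⟪n, N_{b₀}⟫| ≤ 0.379` — two `{111}` families) and whose
height over `Π` is `≤ 0` but `> −2.36 ν_{b₀}`, THREE steepest basal steps (`…RunCutSheetCover.steepest_step`: rise `≥ 0.79 ν` per step under tilt
`≤ 19/50`; axis transport `26·10⁻⁵` per step keeps the tilt) climb through `Π`; the first sign change gives the pair.

* §1 `straddle_advance` — one steepest step appended to an h-chain `c 0 = b₀, …, c t` (`t ≤ 2`) of sites within `1.01 t ν_{b₀}` of `y b₀`: the new site
  rises by `≥ 0.79 ν_{c t}`, has bond length `≤ 1.0011 ν` read from both ends, is an h-site of the ball, and lies within `1.01 (t+1) ν_{b₀}` of `y b₀`;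
* §2 `straddle_chain` — the three-step steepest chain from `b₀` (iteration of §1);
* §3 ★★ `steep_straddle` — the chain together with an index `i ≤ 2` at which the height over `Π` changes sign:
  `⟪n, y (c i) − q₀⟫ ≤ 0 ≤ ⟪n, y (c (i+1)) − q₀⟫` (total rise `≥ 3 · 0.79 · 0.9968 ν_{b₀} > 2.36 ν_{b₀}`).
REGION: all sites used lie within `3.03 ν_{b₀}` of `y b₀` (hypothesis `dist (y b₀) (y j) + 3.03 ν_{b₀} ≤ ρ₁ ν_j`).
[this file: 0 definitions, 3 theorems; imports `…RunCutSheetAccess` (part 22B); standard axioms]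
-/

namespace Summit.AtomisticToContinuum.Crystallization.Theorems.OverbindingBudgetAffineRunCutSheetStraddle

open scoped InnerProductSpace
open Literature.Geometry.DiscreteGeometry
open Summit.AtomisticToContinuum.Crystallization.Theorems.OverbindingBudgetAffineCompressedCutEstablish (nearestDist_pos_of_frame)
open Summit.AtomisticToContinuum.Crystallization.Theorems.OverbindingBudgetAffineRunCutSheetLetter (basal_step_record)
open Summit.AtomisticToContinuum.Crystallization.Theorems.OverbindingBudgetAffineRunCutSheetWalkA (basal_step_kinematics)
open Summit.AtomisticToContinuum.Crystallization.Theorems.OverbindingBudgetAffineRunCutSheetCover (steepest_step)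
open Summit.AtomisticToContinuum.Crystallization.Theorems.OverbindingBudgetAffineRunCutSheetHop (site_charts chain_charts)
open Summit.AtomisticToContinuum.Crystallization.Theorems.OverbindingBudgetAffineRunCutSheetAccess (chain_guard)

variable {N : ℕ}

local notation "E3" => EuclideanSpace ℝ (Fin 3)

section Atlas

/-! ONE chart datum on the ball `B(y j, ρ₁ ν_j)` (verbatim §2 of part 22A / `…RunCutRebase.charts_of_affDeepReg_radius`). -/
variable {y : Fin N → E3} (hy : Function.Injective y) {j : Fin N} {ρ₁ : ℝ}
  {Ac : Fin N → (E3 →ₗ[ℝ] E3)} {Qc : Fin N → (E3 →ₗᵢ[ℝ] E3)} {Pc : Fin N → Finset E3} {fc : Fin N → E3 → E3}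
  (hP : ∀ i, dist (y i) (y j) ≤ ρ₁ * nearestDist y j → Pc i = fccTwoShellPattern ∨ Pc i = hcpTwoShellPattern)
  (hA : ∀ i, dist (y i) (y j) ≤ ρ₁ * nearestDist y j → ∀ v ∈ Pc i, ‖Ac i v - Qc i v‖ ≤ 1 / 1000)
  (hf : ∀ i, dist (y i) (y j) ≤ ρ₁ * nearestDist y j → ∀ v ∈ Pc i,
    fc i v ∈ Set.range y ∧ dist (fc i v) (y i + nearestDist y i • Ac i v) ≤ 1 / 10 ^ 4 * nearestDist y i)
  (hinj : ∀ i, dist (y i) (y j) ≤ ρ₁ * nearestDist y j → Set.InjOn (fc i) ↑(Pc i))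
  (hex : ∀ i, dist (y i) (y j) ≤ ρ₁ * nearestDist y j → ∀ k : Fin N, k ≠ i →
    dist (y k) (y i) ≤ (3 / 2 + 1 / 450) * nearestDist y i → ∃ v ∈ Pc i, fc i v = y k)

include hy hP hA hf hinj hex

/-! ## §1 One steepest step -/

/-- **ONE STEEPEST STEP APPENDED.**  `b₀` an h-site with `dist (y b₀) (y j) + 3.03 ν_{b₀} ≤ ρ₁ ν_j`; `n` a unit vector with `|⟪n, N_{b₀}⟫| ≤ 0.379`
(`N_{b₀}` the unit chart axis); an h-chain `c 0 = b₀, …, c t` (`t ≤ 2`) of the ball with basal steps and `dist (y (c s)) (y b₀) ≤ 1.01 s ν_{b₀}`.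
Then some basal position `u₁` of the chart at `c t` leads to a site `m′` with rise `⟪n, y m′ − y (c t)⟫ ≥ 0.79 ν_{c t}`, bond length `≤ 1.0011 ν`
from both ends, `m′` an h-site of the ball within `1.01 (t+1) ν_{b₀}` of `y b₀`.  (Tilt at `c t`: `0.379 + 26·10⁻⁵·2 ≤ 19/50` by `chain_guard`;
window `ν_{c t} ≤ 1.0032 ν_{b₀}`, `1.0011 · 1.0032 ≤ 1.01`.) [this file · kind: proof] -/
theorem straddle_advance {b₀ : Fin N} (hreg : dist (y b₀) (y j) + 303 / 100 * nearestDist y b₀ ≤ ρ₁ * nearestDist y j)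
    {n : E3} (hn1 : ‖n‖ = 1)
    (htilt : |⟪n, (‖Ac b₀ ((Real.sqrt 18)⁻¹ • intVec ![4, 4, 4])‖⁻¹ • Ac b₀ ((Real.sqrt 18)⁻¹ • intVec ![4, 4, 4]) : E3)⟫_ℝ| ≤ 379 / 1000)
    {c : ℕ → Fin N} {u : ℕ → E3} {t : ℕ} (ht : t ≤ 2) (hc0 : c 0 = b₀)
    (hAll : ∀ s, s ≤ t → dist (y (c s)) (y j) ≤ ρ₁ * nearestDist y j ∧ Pc (c s) = hcpTwoShellPattern)
    (hBll : ∀ s, s < t → u s ∈ hcpTwoShellPattern ∧ u s 0 + u s 1 + u s 2 = 0 ∧ fc (c s) (u s) = y (c (s + 1)))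
    (hD : ∀ s, s ≤ t → dist (y (c s)) (y b₀) ≤ 101 / 100 * s * nearestDist y b₀) :
    ∃ u₁ ∈ hcpTwoShellPattern, u₁ 0 + u₁ 1 + u₁ 2 = 0 ∧ ∃ m' : Fin N, fc (c t) u₁ = y m' ∧
      79 / 100 * nearestDist y (c t) ≤ ⟪n, y m' - y (c t)⟫_ℝ ∧
      ‖y m' - y (c t)‖ ≤ 10011 / 10000 * nearestDist y (c t) ∧ ‖y m' - y (c t)‖ ≤ 10011 / 10000 * nearestDist y m' ∧
      dist (y m') (y j) ≤ ρ₁ * nearestDist y j ∧ Pc m' = hcpTwoShellPattern ∧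
      dist (y m') (y b₀) ≤ 101 / 100 * (t + 1) * nearestDist y b₀ := by
  obtain ⟨hA1, hf1, hinj1, hex1⟩ := chain_charts hA hf hinj hex hAll
  have hν₀ : 0 < nearestDist y (c 0) :=
    nearestDist_pos_of_frame hy (Or.inr rfl) (fun v hv => (hf1 0 (Nat.zero_le _) v hv).1) (hinj1 0 (Nat.zero_le _))
  obtain ⟨⟨σ, hσ, hax⟩, hwin, -⟩ := chain_guard hy hA hf hinj hex (t := t) (by omega) hAll hBll rfl
  rw [hc0] at hax hwin hν₀
  obtain ⟨hball, hPm⟩ := hAll t le_rfl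
  obtain ⟨hAm, hfm, hinjm, hexm⟩ := site_charts hA hf hinj hex hball hPm
  -- the tilt at `c t`
  set Nt : E3 := (‖Ac (c t) ((Real.sqrt 18)⁻¹ • intVec ![4, 4, 4])‖⁻¹ • Ac (c t) ((Real.sqrt 18)⁻¹ • intVec ![4, 4, 4]) : E3) with hNt
  set N0 : E3 := (‖Ac b₀ ((Real.sqrt 18)⁻¹ • intVec ![4, 4, 4])‖⁻¹ • Ac b₀ ((Real.sqrt 18)⁻¹ • intVec ![4, 4, 4]) : E3) with hN0
  have ht' : (t : ℝ) ≤ 2 := by exact_mod_cast ht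
  have htilt' : |⟪n, Nt⟫_ℝ| ≤ 19 / 50 := by
    have e : ⟪n, Nt⟫_ℝ = σ * ⟪n, N0⟫_ℝ + ⟪n, Nt - σ • N0⟫_ℝ := by
      rw [inner_sub_right, real_inner_smul_right n N0 σ]; ring
    have h1 : |σ * ⟪n, N0⟫_ℝ| ≤ 379 / 1000 := by
      rw [abs_mul]; rcases hσ with h | h <;> simp [h, htilt]
    have h2 : |⟪n, Nt - σ • N0⟫_ℝ| ≤ 26 / 100000 * t := by
      refine (abs_real_inner_le_norm _ _).trans ?_
      rw [hn1, one_mul]; exact hax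
    rw [e]
    refine (abs_add_le _ _).trans ?_
    nlinarith [h1, h2, ht']
  -- the steepest step
  obtain ⟨u₁, hu, hu0, hgood⟩ := steepest_step hy hAm hfm hinjm hn1 htilt'
  obtain ⟨m', hm'⟩ := (hfm u₁ hu).1
  obtain ⟨hrise, hlen⟩ := hgood m' hm'.symm
  -- the new site: within `1.01 (t+1) ν_{b₀}` of `y b₀`, hence in the ball
  have hνt : nearestDist y (c t) ≤ 10032 / 10000 * nearestDist y b₀ := by
    have h2 := (abs_le.1 hwin).2
    nlinarith [h2, hν₀.le, ht']
  have hstep : dist (y m') (y (c t)) ≤ 101 / 100 * nearestDist y b₀ := by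
    rw [dist_eq_norm]; exact hlen.trans (by nlinarith [hνt, hν₀.le])
  have hDm : dist (y m') (y b₀) ≤ 101 / 100 * (t + 1) * nearestDist y b₀ :=
    calc dist (y m') (y b₀) ≤ dist (y m') (y (c t)) + dist (y (c t)) (y b₀) := dist_triangle _ _ _
      _ ≤ 101 / 100 * nearestDist y b₀ + 101 / 100 * t * nearestDist y b₀ := by linarith [hD t le_rfl]
      _ = 101 / 100 * (t + 1) * nearestDist y b₀ := by ring
  have hball' : dist (y m') (y j) ≤ ρ₁ * nearestDist y j :=
    calc dist (y m') (y j) ≤ dist (y m') (y b₀) + dist (y b₀) (y j) := dist_triangle _ _ _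
      _ ≤ 101 / 100 * (t + 1) * nearestDist y b₀ + dist (y b₀) (y j) := by linarith
      _ ≤ ρ₁ * nearestDist y j := by nlinarith [hreg, hν₀.le, ht']
  -- … an h-site, and the bond read from the far end
  have hrec := basal_step_record hy hAm hfm hinjm hexm (hP _ hball') (hA _ hball') (hf _ hball') (hinj _ hball') (hex _ hball')
    hu hu0 hm'.symm
  have hkin := basal_step_kinematics hy hAm hfm hinjm hexm (hP _ hball') (hA _ hball') (hf _ hball') (hinj _ hball') (hex _ hball')
    hu hu0 hm'.symm
  exact ⟨u₁, hu, hu0, m', hm'.symm, hrise, hlen, hkin.2.2.2.1, hball', hrec.1, hDm⟩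

/-! ## §2 The three-step steepest chain -/

/-- **THE STEEPEST CHAIN.**  Under the hypotheses of `straddle_advance`, for every `t ≤ 3` there is an h-chain `c 0 = b₀, …, c t` of the ball with
basal steps, `dist (y (c s)) (y b₀) ≤ 1.01 s ν_{b₀}`, rising by `≥ 0.79 ν_{c s}` at every step, with bond lengths `≤ 1.0011 ν` read from both
ends. [this file · kind: proof] -/
theorem straddle_chain {b₀ : Fin N} (hball₀ : dist (y b₀) (y j) ≤ ρ₁ * nearestDist y j) (hP₀ : Pc b₀ = hcpTwoShellPattern)
    (hreg : dist (y b₀) (y j) + 303 / 100 * nearestDist y b₀ ≤ ρ₁ * nearestDist y j) {n : E3} (hn1 : ‖n‖ = 1)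
    (htilt : |⟪n, (‖Ac b₀ ((Real.sqrt 18)⁻¹ • intVec ![4, 4, 4])‖⁻¹ • Ac b₀ ((Real.sqrt 18)⁻¹ • intVec ![4, 4, 4]) : E3)⟫_ℝ| ≤ 379 / 1000) :
    ∀ t, t ≤ 3 → ∃ (c : ℕ → Fin N) (w : ℕ → E3), c 0 = b₀ ∧
      (∀ s, s ≤ t → dist (y (c s)) (y j) ≤ ρ₁ * nearestDist y j ∧ Pc (c s) = hcpTwoShellPattern) ∧
      (∀ s, s < t → w s ∈ hcpTwoShellPattern ∧ w s 0 + w s 1 + w s 2 = 0 ∧ fc (c s) (w s) = y (c (s + 1))) ∧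
      (∀ s, s ≤ t → dist (y (c s)) (y b₀) ≤ 101 / 100 * s * nearestDist y b₀) ∧
      (∀ s, s < t → 79 / 100 * nearestDist y (c s) ≤ ⟪n, y (c (s + 1)) - y (c s)⟫_ℝ ∧
        ‖y (c (s + 1)) - y (c s)‖ ≤ 10011 / 10000 * nearestDist y (c s) ∧
        ‖y (c (s + 1)) - y (c s)‖ ≤ 10011 / 10000 * nearestDist y (c (s + 1))) := by
  intro t
  induction t with
  | zero =>
    intro _
    refine ⟨fun _ => b₀, fun _ => 0, rfl, fun s _ => ⟨hball₀, hP₀⟩, fun s hs => absurd hs (Nat.not_lt_zero _), fun s hs => ?_,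
      fun s hs => absurd hs (Nat.not_lt_zero _)⟩
    have hs0 : s = 0 := by omega
    subst hs0; simp
  | succ t ih =>
    intro ht
    obtain ⟨c, w, hc0, hAll, hBll, hD, hR⟩ := ih (by omega)
    obtain ⟨u₁, hu, hu0, m', hmu, hrise, hlen, hlen', hball', hPm', hDm⟩ :=
      straddle_advance hy hP hA hf hinj hex hreg hn1 htilt (t := t) (by omega) hc0 hAll hBll hD
    refine ⟨fun s => if s ≤ t then c s else m', fun s => if s < t then w s else u₁, by simp [hc0], ?_, ?_, ?_, ?_⟩
    · intro s hs
      by_cases h : s ≤ t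
      · simp only [h, if_true]; exact hAll s h
      · simp only [h, if_false]; exact ⟨hball', hPm'⟩
    · intro s hs
      by_cases h : s < t
      · have h1 : s ≤ t := h.le
        have h2 : s + 1 ≤ t := h
        simp only [h, h1, h2, if_true]; exact hBll s h
      · have hs' : s = t := by omega
        subst hs'
        simp only [lt_irrefl, le_refl, if_true, if_false, Nat.not_succ_le_self]; exact ⟨hu, hu0, hmu⟩
    · intro s hs
      by_cases h : s ≤ t
      · simp only [h, if_true]; exact hD s h
      · have hs' : s = t + 1 := by omega
        subst hs'
        simp only [h, if_false]; push_cast; exact hDm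
    · intro s hs
      by_cases h : s < t
      · have h1 : s ≤ t := h.le
        have h2 : s + 1 ≤ t := h
        simp only [h1, h2, if_true]; exact hR s h
      · have hs' : s = t := by omega
        subst hs'
        simp only [le_refl, if_true, Nat.not_succ_le_self, if_false]; exact ⟨hrise, hlen, hlen'⟩

/-! ## §3 The straddle -/

/-- ★★ **THE STEEPEST STRADDLE.**  `b₀` an h-site of the ball with `dist (y b₀) (y j) + 3.03 ν_{b₀} ≤ ρ₁ ν_j`, `n` a unit vector with
`|⟪n, N_{b₀}⟫| ≤ 0.379`, `q₀` a point with `−2.36 ν_{b₀} < ⟪n, y b₀ − q₀⟫ ≤ 0`.  Then the three-step steepest chain `c` from `b₀` (h-sites of the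
ball, basal steps `w`, `dist (y (c s)) (y b₀) ≤ 1.01 s ν_{b₀}`, rises `≥ 0.79 ν`, bonds `≤ 1.0011 ν` from both ends) CROSSES the plane `(q₀, n)`:
for some `i ≤ 2`, `⟪n, y (c i) − q₀⟫ ≤ 0 ≤ ⟪n, y (c (i+1)) − q₀⟫`.  (Total rise `≥ 0.79 · 0.9968 · 3 ν_{b₀} > 2.36 ν_{b₀}` by the scale window
of `chain_guard`.) [this file · kind: proof] -/
theorem steep_straddle {b₀ : Fin N} (hball₀ : dist (y b₀) (y j) ≤ ρ₁ * nearestDist y j) (hP₀ : Pc b₀ = hcpTwoShellPattern)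
    (hreg : dist (y b₀) (y j) + 303 / 100 * nearestDist y b₀ ≤ ρ₁ * nearestDist y j) {n : E3} (hn1 : ‖n‖ = 1)
    (htilt : |⟪n, (‖Ac b₀ ((Real.sqrt 18)⁻¹ • intVec ![4, 4, 4])‖⁻¹ • Ac b₀ ((Real.sqrt 18)⁻¹ • intVec ![4, 4, 4]) : E3)⟫_ℝ| ≤ 379 / 1000)
    (q₀ : E3) (hh0 : ⟪n, y b₀ - q₀⟫_ℝ ≤ 0) (hh1 : -(59 / 25) * nearestDist y b₀ < ⟪n, y b₀ - q₀⟫_ℝ) :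
    ∃ (c : ℕ → Fin N) (w : ℕ → E3), c 0 = b₀ ∧
      (∀ s, s ≤ 3 → dist (y (c s)) (y j) ≤ ρ₁ * nearestDist y j ∧ Pc (c s) = hcpTwoShellPattern) ∧
      (∀ s, s < 3 → w s ∈ hcpTwoShellPattern ∧ w s 0 + w s 1 + w s 2 = 0 ∧ fc (c s) (w s) = y (c (s + 1))) ∧
      (∀ s, s ≤ 3 → dist (y (c s)) (y b₀) ≤ 101 / 100 * s * nearestDist y b₀) ∧
      (∀ s, s < 3 → 79 / 100 * nearestDist y (c s) ≤ ⟪n, y (c (s + 1)) - y (c s)⟫_ℝ ∧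
        ‖y (c (s + 1)) - y (c s)‖ ≤ 10011 / 10000 * nearestDist y (c s) ∧
        ‖y (c (s + 1)) - y (c s)‖ ≤ 10011 / 10000 * nearestDist y (c (s + 1))) ∧
      ∃ i, i ≤ 2 ∧ ⟪n, y (c i) - q₀⟫_ℝ ≤ 0 ∧ 0 ≤ ⟪n, y (c (i + 1)) - q₀⟫_ℝ := by
  obtain ⟨c, w, hc0, hAll, hBll, hD, hR⟩ := straddle_chain hy hP hA hf hinj hex hball₀ hP₀ hreg hn1 htilt 3 le_rfl
  refine ⟨c, w, hc0, hAll, hBll, hD, hR, ?_⟩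
  -- scale windows along the chain: `ν_{c s} ≥ 0.9968 ν_{b₀}` for `s ≤ 2`
  obtain ⟨hA1, hf1, hinj1, -⟩ := chain_charts hA hf hinj hex hAll
  have hν₀ : 0 < nearestDist y (c 0) :=
    nearestDist_pos_of_frame hy (Or.inr rfl) (fun v hv => (hf1 0 (Nat.zero_le _) v hv).1) (hinj1 0 (Nat.zero_le _))
  have hlow : ∀ s, s ≤ 2 → 9968 / 10000 * nearestDist y b₀ ≤ nearestDist y (c s) := by
    intro s hs
    have hs' : (s : ℝ) ≤ 2 := by exact_mod_cast hs
    obtain ⟨-, hwin, -⟩ := chain_guard hy hA hf hinj hex (t := s) (by omega) (fun s' hs' => hAll s' (by omega))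
      (fun s' hs' => hBll s' (by omega)) rfl
    rw [hc0] at hwin hν₀
    have h1 := (abs_le.1 hwin).1
    nlinarith [h1, hν₀.le, hs']
  rw [hc0] at hν₀
  -- heights `h s = ⟪n, y (c s) − q₀⟫`: consecutive differences are the rises
  have hdiff : ∀ s, s < 3 → 78747 / 100000 * nearestDist y b₀ ≤ ⟪n, y (c (s + 1)) - q₀⟫_ℝ - ⟪n, y (c s) - q₀⟫_ℝ := by
    intro s hs
    have e : ⟪n, y (c (s + 1)) - q₀⟫_ℝ - ⟪n, y (c s) - q₀⟫_ℝ = ⟪n, y (c (s + 1)) - y (c s)⟫_ℝ := by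
      rw [← inner_sub_right]; congr 1; abel
    rw [e]
    nlinarith [(hR s hs).1, hlow s (by omega)]
  have h0 : ⟪n, y (c 0) - q₀⟫_ℝ ≤ 0 := by rw [hc0]; exact hh0
  have h0' : -(59 / 25) * nearestDist y b₀ < ⟪n, y (c 0) - q₀⟫_ℝ := by rw [hc0]; exact hh1
  have d0 := hdiff 0 (by norm_num)
  have d1 := hdiff 1 (by norm_num)
  have d2 := hdiff 2 (by norm_num)
  by_cases h1 : 0 ≤ ⟪n, y (c 1) - q₀⟫_ℝ
  · exact ⟨0, by norm_num, h0, h1⟩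
  by_cases h2 : 0 ≤ ⟪n, y (c 2) - q₀⟫_ℝ
  · exact ⟨1, by norm_num, (not_le.1 h1).le, h2⟩
  refine ⟨2, le_rfl, (not_le.1 h2).le, ?_⟩
  have : (0 : ℝ) ≤ nearestDist y b₀ := hν₀.le
  norm_num at d0 d1 d2 ⊢
  nlinarith [d0, d1, d2, h0', this]

end Atlas

end Summit.AtomisticToContinuum.Crystallization.Theorems.OverbindingBudgetAffineRunCutSheetStraddle
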